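import Summits.ValiantsHypothesis.ValiantsHypothesis.Theorems.BarrierLeverPartitionMinorsHitByVPNearPrincipalLayouts

/-!
# Route BarrierLever — item `PartitionMinorsHitByVP` (stmt-ValiantsHypothesis-19717):
# near-principal layouts, CARDINALITY FORM — «at most `(h+h)^c` rows are not columns» suffices

Helper file (`--supports stmt-ValiantsHypothesis-19717`; cell valiant-natproofs, rung V4, 𝒟-side, prover seat
val-np-p3). Closes NO item. `…partitionMinor_hit_of_nearPrincipal` takes the re-pairing `β` of unmatched rows with
unmatched columns as data; here it is DERIVED: for injective `u, w` the rows that are columns and the columns that are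
rows are equinumerous (matched pairs `u i = w j` project injectively to both sides), hence so are their complements,
and any bijection between the complements serves as `β`.

* `partitionMinor_hit_of_few_unmatched` — `u, w` injective, `h ≥ 2`, `#{i : ∀ j, w j ≠ u i} ≤ (h+h)^c` ⇒ the layout
  is hit by `SmallCircuits ℂ (h+h) (c+3)`;
* `partitionMinor_hit_of_cosmall` — in particular every injective layout with `2^h ≤ r + (h+h)^c` (co-small) is hit.

WHAT THIS IS NOT: nothing for layouts far from principal ones; nothing on crux 14610.
-/

-- layout Summits/ValiantsHypothesis/ValiantsHypothesis forces the duplicated namespace component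
set_option linter.dupNamespace false

namespace Summit.ValiantsHypothesis.ValiantsHypothesis.Theorems.BarrierLever.ProductStateSums

open Finset MvPolynomial Literature.Barriers.ValiantsHypothesis

/-- For injective `u, w`, the matched rows and the matched columns are equinumerous. -/
theorem card_matched_rows_eq {h r : ℕ} (u w : Fin r → Finset (Fin h))
    (hu : Function.Injective u) (hw : Function.Injective w) :
    (univ.filter (fun i : Fin r => ∃ j, w j = u i)).card =
      (univ.filter (fun j : Fin r => ∃ i, u i = w j)).card := by
  classical
  -- both equal the number of matched pairs
  set P : Finset (Fin r × Fin r) := univ.filter (fun p : Fin r × Fin r => u p.1 = w p.2) with hP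
  have h1 : (univ.filter (fun i : Fin r => ∃ j, w j = u i)).card = P.card := by
    rw [← Finset.card_image_of_injOn (s := P) (f := Prod.fst) ?_]
    · congr 1
      ext i
      simp only [Finset.mem_filter, Finset.mem_univ, true_and, Finset.mem_image, hP, Prod.exists,
        exists_and_right, exists_eq_right]
      constructor
      · rintro ⟨j, hj⟩; exact ⟨j, hj.symm⟩
      · rintro ⟨j, hj⟩; exact ⟨j, hj.symm⟩
    · rintro ⟨i, j⟩ hij ⟨i', j'⟩ hij' (hfst : i = i')
      simp only [hP, Finset.coe_filter, Set.mem_setOf_eq, Finset.mem_univ, true_and] at hij hij'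
      subst hfst
      have : j = j' := hw (hij.symm.trans hij')
      subst this; rfl
  have h2 : (univ.filter (fun j : Fin r => ∃ i, u i = w j)).card = P.card := by
    rw [← Finset.card_image_of_injOn (s := P) (f := Prod.snd) ?_]
    · congr 1
      ext j
      simp only [Finset.mem_filter, Finset.mem_univ, true_and, Finset.mem_image, hP, Prod.exists,
        exists_eq_right]
    · rintro ⟨i, j⟩ hij ⟨i', j'⟩ hij' (hsnd : j = j')
      simp only [hP, Finset.coe_filter, Set.mem_setOf_eq, Finset.mem_univ, true_and] at hij hij'
      subst hsnd
      have : i = i' := hu (hij.trans hij'.symm)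
      subst this; rfl
  rw [h1, h2]

/-- For injective `u, w`, the UNMATCHED rows and the unmatched columns are equinumerous. -/
theorem card_unmatched_rows_eq {h r : ℕ} (u w : Fin r → Finset (Fin h))
    (hu : Function.Injective u) (hw : Function.Injective w) :
    (univ.filter (fun i : Fin r => ∀ j, w j ≠ u i)).card =
      (univ.filter (fun j : Fin r => ∀ i, u i ≠ w j)).card := by
  classical
  have e1 := Finset.card_filter_add_card_filter_not (s := (univ : Finset (Fin r)))
    (fun i : Fin r => ∃ j, w j = u i)
  have e2 := Finset.card_filter_add_card_filter_not (s := (univ : Finset (Fin r)))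
    (fun j : Fin r => ∃ i, u i = w j)
  have hA : univ.filter (fun i : Fin r => ¬ ∃ j, w j = u i) = univ.filter (fun i : Fin r => ∀ j, w j ≠ u i) := by
    ext i; simp
  have hB : univ.filter (fun j : Fin r => ¬ ∃ i, u i = w j) = univ.filter (fun j : Fin r => ∀ i, u i ≠ w j) := by
    ext j; simp
  rw [hA] at e1; rw [hB] at e2
  have := card_matched_rows_eq u w hu hw
  omega

/-- **Near-principal layouts, cardinality form** (`b = c + 3`, `h ≥ 2`): if at most `(h+h)^c` rows are not columns,
the layout is hit. -/
theorem partitionMinor_hit_of_few_unmatched (c h : ℕ) (hh : 2 ≤ h) (r : ℕ)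
    (u w : Fin r → Finset (Fin h)) (hu : Function.Injective u) (hw : Function.Injective w)
    (hA : (univ.filter (fun i : Fin r => ∀ j, w j ≠ u i)).card ≤ (h + h) ^ c) :
    ∃ f ∈ SmallCircuits ℂ (h + h) (c + 3),
      (Matrix.of fun i j : Fin r => MvPolynomial.coeff
        (∑ a ∈ u i, Finsupp.single (Fin.castAdd h a) 1 +
          ∑ c ∈ w j, Finsupp.single (Fin.natAdd h c) 1) f).det ≠ 0 := by
  classical
  set A : Finset (Fin r) := univ.filter (fun i : Fin r => ∀ j, w j ≠ u i) with hAdef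
  set B : Finset (Fin r) := univ.filter (fun j : Fin r => ∀ i, u i ≠ w j) with hBdef
  have hcard : Fintype.card {i // i ∈ A} = Fintype.card {j // j ∈ B} := by
    rw [Fintype.card_coe, Fintype.card_coe]
    exact card_unmatched_rows_eq u w hu hw
  obtain ⟨e⟩ : Nonempty ({i // i ∈ A} ≃ {j // j ∈ B}) := Fintype.card_eq.mp hcard
  let β : Fin r → Fin r := fun i => if hi : i ∈ A then (e ⟨i, hi⟩).1 else i
  have hmemA : ∀ i, i ∈ A ↔ ∀ j, w j ≠ u i := fun i => by simp [hAdef]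
  have hmemB : ∀ j, j ∈ B ↔ ∀ i, u i ≠ w j := fun j => by simp [hBdef]
  refine partitionMinor_hit_of_nearPrincipal c h hh r u w hu hw β ?_ ?_ hA
  · intro i hi
    have hiA : i ∈ A := (hmemA i).mpr hi
    have hb : β i ∈ B := by simp only [β, dif_pos hiA]; exact (e ⟨i, hiA⟩).2
    exact (hmemB _).mp hb
  · intro i i' hi hi' hβ
    have hiA : i ∈ A := (hmemA i).mpr hi
    have hiA' : i' ∈ A := (hmemA i').mpr hi'
    simp only [β, dif_pos hiA, dif_pos hiA'] at hβ
    have := e.injective (Subtype.ext hβ)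
    exact congrArg Subtype.val this

/-- **Co-small layouts are hit**: every injective layout with `2^h ≤ r + (h+h)^c` rows (`h ≥ 2`) is hit by
`SmallCircuits ℂ (h+h) (c+3)` — at most `2^h − r ≤ (h+h)^c` subsets are not rows, so at most that many columns
(hence rows, by equinumerosity) are unmatched. -/
theorem partitionMinor_hit_of_cosmall (c h : ℕ) (hh : 2 ≤ h) (r : ℕ) (hr : 2 ^ h ≤ r + (h + h) ^ c)
    (u w : Fin r → Finset (Fin h)) (hu : Function.Injective u) (hw : Function.Injective w) :
    ∃ f ∈ SmallCircuits ℂ (h + h) (c + 3),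
      (Matrix.of fun i j : Fin r => MvPolynomial.coeff
        (∑ a ∈ u i, Finsupp.single (Fin.castAdd h a) 1 +
          ∑ c ∈ w j, Finsupp.single (Fin.natAdd h c) 1) f).det ≠ 0 := by
  classical
  refine partitionMinor_hit_of_few_unmatched c h hh r u w hu hw ?_
  -- unmatched rows inject into subsets that are not columns: `u '' A ⊆ univ \ range w`
  set A : Finset (Fin r) := univ.filter (fun i : Fin r => ∀ j, w j ≠ u i) with hAdef
  have himg : (A.image u).card = A.card := Finset.card_image_of_injective _ hu
  have hdisj : Disjoint (A.image u) (univ.image w) := by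
    rw [Finset.disjoint_left]
    intro U hU hU'
    obtain ⟨i, hi, rfl⟩ := Finset.mem_image.mp hU
    obtain ⟨j, -, hj⟩ := Finset.mem_image.mp hU'
    exact ((Finset.mem_filter.mp hi).2 j) hj
  have hunion : ((A.image u) ∪ (univ.image w)).card ≤ 2 ^ h := by
    calc ((A.image u) ∪ (univ.image w)).card ≤ (univ : Finset (Finset (Fin h))).card := Finset.card_le_univ _
      _ = 2 ^ h := by simp
  rw [Finset.card_union_of_disjoint hdisj, himg, Finset.card_image_of_injective _ hw, Finset.card_univ,
    Fintype.card_fin] at hunion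
  omega

end Summit.ValiantsHypothesis.ValiantsHypothesis.Theorems.BarrierLever.ProductStateSums
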